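import Literature.NumberTheory.EllipticCurves.ReductionHomomorphism
import HarnessLib

/-!
# `E₀(K)` by valuations: a point has nonsingular reduction iff `v(x) > 1` or a partial derivative
# of the Weierstrass polynomial is a unit (proofs only)

Topic `NumberTheory/EllipticCurves`; a supplement to `ReductionHomomorphism.lean` (Silverman, *AEC*
VII.2). For a Weierstrass equation `W` over a valuation ring `R` of the valued field `(K, v)`
(`hv : v.Integers R`) and an affine point `P = (x, y)` of `W/K`, the predicate
`WeierstrassCurve.HasNonsingularReduction W P` ("`P ∈ E₀(K)`": `x ∉ R`, or `x, y ∈ R` with `(x̄, ȳ)`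
nonsingular on `W̃ = W mod 𝔪`) is characterised WITHOUT residue fields, purely by the valuation:

* `WeierstrassCurve.hasNonsingularReduction_some_iff_valuation` —
  **`P ∈ E₀(K) ↔ v(x) > 1 ∨ v(a₁y − (3x² + 2a₂x + a₄)) = 1 ∨ v(2y + a₁x + a₃) = 1`**
  (the two expressions are `∓` the partial derivatives `∂F/∂x`, `∂F/∂y` of the Weierstrass polynomial at
  `P`; for `x ∈ R` they lie in `R`, and "`= 1`" says "is a unit", i.e. nonzero in the residue field —
  Silverman's criterion for `(x̄, ȳ)` to be a nonsingular point of `W̃`, *AEC* III.1 / VII.2).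

Consequences drawn elsewhere: `E₀(K)` is stable under every isometric automorphism of `K` fixing the
coefficients, and for a valued subfield `K₀ ⊆ K` with `v|_{K₀} = v₀`, `E₀(K) ∩ E(K₀) = E₀(K₀)` — both are
immediate from this criterion since its right-hand side is a valuation of a polynomial in `x, y, aᵢ`.

## References

* J. H. Silverman, *The Arithmetic of Elliptic Curves*, 2nd ed., GTM 106 (2009), III.1 (singular points:
  both partial derivatives vanish), VII.2 (the reduction map, `E₀(K)`, Prop. VII.2.1). [SilvermanAEC2009]

## Design

Proofs only (no definition); the setting and notation are those of `ReductionHomomorphism.lean`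
(`hv : v.Integers R`, `W : WeierstrassCurve R`, points of `W.baseChange K`); Mathlib's
`WeierstrassCurve.Affine.nonsingular_iff'` supplies the shape of the nonsingularity condition.
-/

namespace WeierstrassCurve

variable {K : Type*} [Field K] {Γ₀ : Type*} [LinearOrderedCommGroupWithZero Γ₀]
  {v : Valuation K Γ₀} {R : Type*} [CommRing R] [IsLocalRing R] [Algebra R K]
  {W : WeierstrassCurve R}

/-- In a local ring, `residue a ≠ 0 ↔ a` is a unit. [folklore] -/
private theorem residue_ne_zero_iff_isUnit' (a : R) :
    IsLocalRing.residue R a ≠ 0 ↔ IsUnit a := by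
  rw [Ne, IsLocalRing.residue_eq_zero_iff, IsLocalRing.mem_maximalIdeal, mem_nonunits_iff, not_not]

omit [IsLocalRing R] in
/-- For `a ∈ R`: `a` is a unit iff `v(a) = 1`. [folklore] -/
private theorem isUnit_iff_valuation_eq_one' (hv : v.Integers R)
    (a : R) : IsUnit a ↔ v (algebraMap R K a) = 1 := by
  refine ⟨fun h => hv.one_of_isUnit h, fun h => hv.isUnit_of_one ?_ h⟩
  rw [isUnit_iff_ne_zero, ne_eq, ← v.zero_iff, h]
  exact one_ne_zero

/-- The `x`-derivative expression of the reduced equation at `(ā, b̄)` is the residue of the integral one.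
[folklore] -/
private theorem residue_derivX_eq (a b : R) :
    (W.map (IsLocalRing.residue R)).a₁ * IsLocalRing.residue R b -
        (3 * IsLocalRing.residue R a ^ 2 + 2 * (W.map (IsLocalRing.residue R)).a₂ * IsLocalRing.residue R a +
          (W.map (IsLocalRing.residue R)).a₄) =
      IsLocalRing.residue R (W.a₁ * b - (3 * a ^ 2 + 2 * W.a₂ * a + W.a₄)) := by
  simp only [map_a₁, map_a₂, map_a₄, map_sub, map_add, map_mul, map_pow, map_ofNat]

/-- The `y`-derivative expression of the reduced equation at `(ā, b̄)` is the residue of the integral one.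
[folklore] -/
private theorem residue_derivY_eq (a b : R) :
    2 * IsLocalRing.residue R b + (W.map (IsLocalRing.residue R)).a₁ * IsLocalRing.residue R a +
        (W.map (IsLocalRing.residue R)).a₃ =
      IsLocalRing.residue R (2 * b + W.a₁ * a + W.a₃) := by
  simp only [map_a₁, map_a₃, map_add, map_mul, map_ofNat]

omit [IsLocalRing R] in
/-- The `x`-derivative expression over `K` at `(a, b) ∈ R²` is the image of the integral one. [folklore] -/
private theorem algebraMap_derivX_eq (a b : R) :
    (W.baseChange K).a₁ * algebraMap R K b -
        (3 * algebraMap R K a ^ 2 + 2 * (W.baseChange K).a₂ * algebraMap R K a + (W.baseChange K).a₄) =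
      algebraMap R K (W.a₁ * b - (3 * a ^ 2 + 2 * W.a₂ * a + W.a₄)) := by
  simp only [baseChange, map_a₁, map_a₂, map_a₄, map_sub, map_add, map_mul, map_pow, map_ofNat]

omit [IsLocalRing R] in
/-- The `y`-derivative expression over `K` at `(a, b) ∈ R²` is the image of the integral one. [folklore] -/
private theorem algebraMap_derivY_eq (a b : R) :
    2 * algebraMap R K b + (W.baseChange K).a₁ * algebraMap R K a + (W.baseChange K).a₃ =
      algebraMap R K (2 * b + W.a₁ * a + W.a₃) := by
  simp only [baseChange, map_a₁, map_a₃, map_add, map_mul, map_ofNat]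

/-- **`E₀(K)` by valuations.** For a Weierstrass equation `W` over a valuation ring `R` of `(K, v)`
and an affine point `P = (x, y)` of `W/K`: `P` has nonsingular reduction iff `v(x) > 1` (then
`P ∈ E₁(K) ⊆ E₀(K)`) or one of the partial-derivative expressions `a₁y − (3x² + 2a₂x + a₄)`,
`2y + a₁x + a₃` of the Weierstrass polynomial at `P` has valuation exactly `1` (for `x ∈ R` these are
elements of `R`, and valuation `1` means nonzero reduction: Silverman's criterion that `(x̄, ȳ)` be a
NONSINGULAR point of `W̃`). [cite: SilvermanAEC2009, VII.2 Prop. 2.1 and III.1 (PDF pp. 167, 42)] -/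
theorem hasNonsingularReduction_some_iff_valuation (hv : v.Integers R) {x y : K}
    (h : (W.baseChange K).toAffine.Nonsingular x y) :
    W.HasNonsingularReduction (.some x y h) ↔
      1 < v x ∨
        v ((W.baseChange K).a₁ * y - (3 * x ^ 2 + 2 * (W.baseChange K).a₂ * x + (W.baseChange K).a₄)) = 1 ∨
          v (2 * y + (W.baseChange K).a₁ * x + (W.baseChange K).a₃) = 1 := by
  have hinj : Function.Injective (algebraMap R K) := hv.hom_inj
  constructor
  · rintro (hx | ⟨x₀, y₀, rfl, rfl, hns⟩)
    · exact Or.inl ((Literature.NumberTheory.EllipticCurves.not_mem_range_iff hv).mp hx)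
    · right
      obtain ⟨-, hd⟩ := (Affine.nonsingular_iff' _ _).mp hns
      rcases hd with hd | hd
      · left
        rw [residue_derivX_eq, residue_ne_zero_iff_isUnit',
          isUnit_iff_valuation_eq_one' hv] at hd
        rwa [algebraMap_derivX_eq]
      · right
        rw [residue_derivY_eq, residue_ne_zero_iff_isUnit',
          isUnit_iff_valuation_eq_one' hv] at hd
        rwa [algebraMap_derivY_eq]
  · intro hrhs
    by_cases hx : 1 < v x
    · exact Or.inl ((Literature.NumberTheory.EllipticCurves.not_mem_range_iff hv).mpr hx)
    · rw [not_lt] at hx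
      have hy : v y ≤ 1 := Literature.NumberTheory.EllipticCurves.v_Y_le_one_of_v_X_le_one hv h.1 hx
      obtain ⟨x₀, rfl⟩ := hv.exists_of_le_one hx
      obtain ⟨y₀, rfl⟩ := hv.exists_of_le_one hy
      refine Or.inr ⟨x₀, y₀, rfl, rfl, ?_⟩
      have heq : W.toAffine.Equation x₀ y₀ :=
        (Literature.NumberTheory.EllipticCurves.map_equation_iff hinj).mp h.1
      refine (Affine.nonsingular_iff' _ _).mpr ⟨heq.map (IsLocalRing.residue R), ?_⟩
      rcases hrhs with hx' | hd | hd
      · exact absurd hx' (not_lt.mpr hx)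
      · left
        rw [residue_derivX_eq, residue_ne_zero_iff_isUnit',
          isUnit_iff_valuation_eq_one' hv, ← algebraMap_derivX_eq]
        exact hd
      · right
        rw [residue_derivY_eq, residue_ne_zero_iff_isUnit',
          isUnit_iff_valuation_eq_one' hv, ← algebraMap_derivY_eq]
        exact hd

/-- The same criterion for membership in the subgroup `E₀(K) = W.nonsingularReductionSubgroup hv`.
[cite: SilvermanAEC2009, VII.2 Prop. 2.1 (PDF p. 167)] -/
theorem some_mem_nonsingularReductionSubgroup_iff_valuation (hv : v.Integers R) {x y : K}
    (h : (W.baseChange K).toAffine.Nonsingular x y) :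
    (.some x y h : (W.baseChange K).toAffine.Point) ∈ W.nonsingularReductionSubgroup hv ↔
      1 < v x ∨
        v ((W.baseChange K).a₁ * y - (3 * x ^ 2 + 2 * (W.baseChange K).a₂ * x + (W.baseChange K).a₄)) = 1 ∨
          v (2 * y + (W.baseChange K).a₁ * x + (W.baseChange K).a₃) = 1 := by
  rw [mem_nonsingularReductionSubgroup_iff]
  exact hasNonsingularReduction_some_iff_valuation hv h

end WeierstrassCurve
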